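import Literature.AnabelianGeometry.EtaleTheta.FrobenioidMonoTheta

/-!
# [EtTh] §5: "`B_N` is Aut-ample" follows from the section `s^⊓-gp_N` (p. 330–331 / PDF pp. 104–105)

Mochizuki, *The étale theta function …*, Publ. RIMS **45** (2009)
[cite: MochizukiEtTh2009, §5 p.330–331 (PDF pp.104–105)].  Seat abc-iut-L2-t4 (§5 owner); PROOF-ONLY companion of
`FrobenioidMonoTheta.lean` (FROZEN; nothing there is edited).

In print (p.330 (PDF p.104)) "it follows that `B_N` is Aut-ample" is deduced from the descent of the zero divisor
`Div(s^⊓_N)` to `A_⊚` (Prop. 1.4 (i)), and the bi-Kummer sections `s^⊓-gp_N, s^⊔-gp_N` (p.331 (PDF p.105)) are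
constructed afterwards.  In abc-iut-L2-t4's typing the homomorphism `s^⊓-gp_N : Aut_D(B_N^bs) → Aut_C(B_N)` is part
of the §5 DATA (`ThetaFrobenioid.sgpCap`) with its printed defining relation `SgpCapSpec` as a named input; since
that relation makes `s^⊓-gp_N` a SECTION of `Aut_C(B_N) → Aut_D(B_N^bs)` (`sgpCapSection_of`, PROVED in
`FrobenioidThetaBiKummer.lean`), the surjectivity "`B_N` is Aut-ample" (`AutAmpleBN`, [FrdI] Def. 1.2 (iv)) is a
CONSEQUENCE of the other named inputs — so the field `autAmpleBN` of the bundle `ThetaFrobenioid.Facts` is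
redundant, and a constructor `Facts.of` without it is provided for whoever instantiates the bundle at the genuine
§5 data (MERGE-PLAN row 12, HOME/staging/L2/L2-t4/MERGE-PLAN.md).  HONEST FRAMING: kernel facts about the typed
interface; nothing of [EtTh] is asserted; no side is taken on anything downstream.
-/

namespace Literature.AnabelianGeometry.EtaleTheta

open CategoryTheory

universe w v v' u u'

namespace ThetaFrobenioid

variable {C : Type u} [Category.{v} C] {D : Type u'} [Category.{v'} D] (𝔉 : ThetaFrobenioid.{w} C D)

/-- **`B_N` is Aut-ample** ([FrdI] Def. 1.2 (iv): `Aut_C(B_N) → Aut_D(B_N^bs)` surjective; p.330 (PDF p.104)) as soon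
as `s^⊓-gp_N` is a section of that map — every `g ∈ Aut_D(B_N^bs)` is `(s^⊓-gp_N(g))^bs`.
[cite: MochizukiEtTh2009, §5 p.330–331 (PDF pp.104–105)] -/
theorem autAmpleBN_of_sgpCapSection (hsec : 𝔉.SgpCapSection) : 𝔉.AutAmpleBN :=
  fun g => ⟨𝔉.sgpCap g, hsec g⟩

/-- **`B_N` is Aut-ample** from the printed defining relation of `s^⊓-gp_N` (p.331 (PDF p.105), `SgpCapSpec`) and the
section property of `s^trv_N` ([FrdI] Prop. 5.6, `StrvSection`), via `sgpCapSection_of`.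
[cite: MochizukiEtTh2009, §5 p.330–331 (PDF pp.104–105)] -/
theorem autAmpleBN_of_spec (hcap : 𝔉.SgpCapSpec) (hstrv : 𝔉.StrvSection) : 𝔉.AutAmpleBN :=
  𝔉.autAmpleBN_of_sgpCapSection (𝔉.sgpCapSection_of hcap hstrv)

/-- For the bundle of §5 named inputs, the Aut-ampleness field is implied by the others.
[cite: MochizukiEtTh2009, §5 p.330–331 (PDF pp.104–105)] -/
theorem Facts.autAmpleBN_redundant (H : 𝔉.Facts) : 𝔉.AutAmpleBN :=
  𝔉.autAmpleBN_of_sgpCapSection H.sgpCapSection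

/-- **Constructor of the `Facts` bundle without the redundant Aut-ampleness field**: the defining relations of
`s^⊓-gp_N, s^⊔-gp_N` (p.331 (PDF p.105)), the section property of `s^trv_N` ([FrdI] Prop. 5.6), the bi-Kummer cocycle
(Prop. 4.3 (iii)), the arithmetic step of Lemma 5.8, and total epimorphicity at `s^⊓_N, s^⊔_N` ([FrdI] Def. 1.3)
suffice.  [cite: MochizukiEtTh2009, §5 p.330–331 (PDF pp.104–105)] -/
theorem Facts.of (hcap : 𝔉.SgpCapSpec) (hcup : 𝔉.SgpCupSpec) (hstrv : 𝔉.StrvSection)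
    (hdiff : 𝔉.BiKummerDifferenceMem) (hK : 𝔉.ConstantsActByCyclotome) (hepi : Epi 𝔉.sCap)
    (hepi' : Epi 𝔉.sCup) : 𝔉.Facts where
  sgpCapSpec := hcap
  sgpCupSpec := hcup
  strvSection := hstrv
  biKummerDifferenceMem := hdiff
  autAmpleBN := 𝔉.autAmpleBN_of_spec hcap hstrv
  constantsActByCyclotome := hK
  epi_sCap := hepi
  epi_sCup := hepi'

/-- In a totally epimorphic Frobenioid ([FrdI] Def. 1.3: every arrow is an epimorphism) the two epimorphicity inputs
are automatic.  [cite: MochizukiEtTh2009, §5 p.331 (PDF p.105)] -/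
theorem Facts.of_totallyEpi (hall : ∀ ⦃X Y : C⦄ (f : X ⟶ Y), Epi f) (hcap : 𝔉.SgpCapSpec)
    (hcup : 𝔉.SgpCupSpec) (hstrv : 𝔉.StrvSection) (hdiff : 𝔉.BiKummerDifferenceMem)
    (hK : 𝔉.ConstantsActByCyclotome) : 𝔉.Facts :=
  Facts.of 𝔉 hcap hcup hstrv hdiff hK (hall _) (hall _)

end ThetaFrobenioid

end Literature.AnabelianGeometry.EtaleTheta
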